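import Literature.MathematicalPhysics.QuantumFieldTheory.Balaban1983to89.B16MergeHorizon

/-!
# `Balaban1983to89.B16Overhang` — [Balaban1989LargeFieldII] p. 387, (1.88): the COST half of the absorption sentence.

v1.1 (DOCFIX, docstring-only; every declaration byte-unchanged): the quotation of (1.88) below is now VERBATIM from the
page render (v1 paraphrased it inside quotation marks — cross-read C-ref6g21-1 V1); two READING sentences that echoed
the paraphrased remainder are re-worded to print's `O(1)2(100M)^dR^{d+2}_{j+1}`.
The DEAD OVERHANG of a binary merger `Z = X ∪ Y` — the cubes of `S^{m}(Z)` outside the iterate of the piece still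
alive — summed over the merged horizon, is at most a FEE linear in the memory `N = R_{j+1}` plus an ARBITRARILY SMALL
multiple of the partner's tree length (cell `STEP.md` §7.11 (4) / §11 row O-F4, the binder `hover` = (G-AMORT) of
`Step.Budget.controlsAm_merge` (`…StepInhabited` Part N) AT `|S| = 2`, in cube currency; `GAPS.md` rows G-b02g11-1 /
C-b02g11-2; `DIVERGENCE.md` D-b02g11.1; unit b2b-balaban-b02, gen 11 — NEW leaf module, imports `…B16MergeHorizon` and
modifies nothing).

CITATION HEADER (lean-in-tree rule 2026-08-18).  Source under audit: T. Bałaban, *Large field renormalization. II.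
Localization, exponentiation, and bounds for the 𝐑 operation*, Commun. Math. Phys. **122**, 355–392 (1989)
[Balaban1989LargeFieldII] (cell paper B16; held `paper:balaban1989-cmp122-large-field-ii`, journal page = PDF page
+ 354).  The passage p. 387 [PDF 33] ll. 2–16 with (1.88) was READ AS AN IMAGE by the typist of `…B16Absorption` on the
x2 render `b2b-balaban-ref1/pages/1989-cmp122-large-field-II/1989-cmp122-large-field-II-p033-x2.png` and is quoted in
full in the header of that module; the sentence adjudicated here is (p. 387 ll. 8–15): *"The domain S^{K₁}(X) satisfies
the conditions (i), (ii), in particular it is contained in a cube of the size 100MR_{j+1+K₁}, and it intersects the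
domains S^{K₁}(Y). It is clear that applying n₁ times the operation S to the last domain, where n₁ is a rather small
number, e.g., n₁ < 10, we obtain the domain S^{K₁+n₁}(Y) containing S^{K₁+n₁}(X). This implies that
S^{n−j−1}(Z) = S^{n−j−1}(Y) for n ≧ j + 1 + K₁ + n₁, and that K ≦ K₂ + n₁ + R_{j+1}."*, used in (1.88) p. 387
— VERBATIM from the x2 render READ AS AN IMAGE for v1.1 (v1 carried a PARAPHRASE of this chain inside quotation marks:
cross-read `REFEREE6.md` E103 / cell `GAPS.md` C-ref6g21-1, violation V1; corrected here, nothing else changed):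
*"To prove the statement for κ_{j+1}(Z) we estimate the sum in (1.80):
Σ_{n=j+2}^{j+1+K} O(1)M^dR^{d+1}_{j+1}d′_n(S^{n−j−1}(Z)) ≦ Σ_{n=j+2}^{j+1+K₁+n₁} O(1)M^dR^{d+1}_{j+1}d′_n(S^{n−j−1}(X))
+ Σ_{n=j+2}^{j+1+K₂+n₁+R_{j+1}} O(1)M^dR^{d+1}_{j+1}d′_n(S^{n−j−1}(Y)) ≦ κ_{j+1}(X) + κ_{j+1}(Y) + O(1)2(100M)^dR^{d+2}_{j+1}
≦ κ_{j+1}(Z) − 2(1 + β₀)^{−1}p₀(g_{j+1}) + O(1)3(100M)^dR^{d+2}_{j+1} ≦ κ_{j+1}(Z), (1.88) for p₀ large and γ small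
enough."* (the weights printed in (1.88) are the CONSTANT `O(1)M^dR^{d+1}_{j+1}`; p. 387 ll. 4–7 precede it with
*"… hence the intersection of S^{n−j−1}(X), S^{n−j−1}(Y), for n > j + 1, contains at least a cube of the size 20MR_n.
This implies that d′_n(S^{n−j−1}(Z)) ≦ d′_n(S^{n−j−1}(X)) + d′_n(S^{n−j−1}(Y))."*).  The definition of the
number `K` (p. 384 [PDF 30]: *"the number K is the smallest positive integer having the property that the domain
S^K(Z) … satisfies the conditions (i), (ii), with N = R_j"*) and the conditions (i), (ii) of [Balaban1989LargeFieldI]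
p. 177 are the ones typed by `…B16StoppingRule`.  The paper is a manuscript UNDER
ADJUDICATION by the audit cell `pub-balaban`: NOTHING printed in it is asserted here; every `theorem` below is finite
combinatorics on `ℤᵈ` and elementary real arithmetic, proved without `sorry` and without new axioms, over the EXISTING
definitions `B13ScaleTransfer.{Pt, FaceConnected}`, `TreeLength.{treeLen, closureIdx}`, `B16SProfile.{Sop, Siter,
ratio, Qprod, DropCtl}`, `B16MergeGeometry.Touch`, `B16Absorption.{shrink, width, gains, cdiv}`,
`B16StoppingRule.{CondI, CondII, StopAt}`, using BY NAME `B16MergeHorizon.{Siter_add, ratio_shift_fun, dropCtl_shift,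
near_of_condI_touch, altGain_ratio, div_two_le_gains_of_altGain, width_le_eighty}`, `B16Absorption.{card_Siter_union_le,
card_Siter_le_pow, shrink_le_cdiv_pow, shrink_le_one_of_gains, cdiv_le_self, width_nonneg}`,
`B16MergeGeometry.{exists_common_Siter, Siter_union}`, `B16StoppingRule.condI_of_lt_one`,
`B16SProfile.{half_pow_mul_treeLen_ge, ratio_pos, Siter_nonempty}`, `TreeLength.treeLen_nonneg`.  The one `def`
(`overhang`, the dead overhang profile in cube currency) is CELL BOOKKEEPING, NOT A PRINTED NOTION (print asserts there
is no overhang).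

CONTEXT (cell, not print).  `…B16Absorption` REFUTES the printed containment `S^{K₁+n₁}(Y) ⊇ S^{K₁+n₁}(X)` for every
uniform `n₁` (`no_uniform_absorption`) and PROVES the one-layer substitute; `…B16MergeHorizon` derives the HORIZON
consequence «K ≦ K₂ + 13 + R_{j+1}» (`find_stopAt_merge_le'`).  The COST consequence — the first `≦` of (1.88) with NO
`Z`-overhang term — fails with it; the cell's typed repair (`Step.Budget.controlsAm_merge`, f2 gen 17) carries a
`θ`-cushioned budget and isolates the geometric input as ONE binder `hover` = (G-AMORT): the cost of the dead overhang
`o_n` over the merged horizon is at most `η·(creation-scale cost of the pieces) + (|S| − 1)·Fee` for some `η < 1` and a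
fee `Fee = O_d(1)·M^dR_{j+1}^{d+2}`.  THIS MODULE INHABITS the geometric content of that binder for a BINARY merger
(`|S| = 2`) in the ℤᵈ index model, in CUBE currency and with unit weights (the CELL's typed weights
`Step.Budget.Consts.cost n` = `O(1)M^dR_n^{d+1}` have bounded ratio `≤ L^{d+1}` along the horizon by (2.9a) =
`Step.Budget.RStepLe`, `weighted_sum_le`; (1.88) itself prints the constant weight `O(1)M^dR^{d+1}_{j+1}`), for EVERY
`η > 0`.

WHAT IS PROVED (unconditionally; every dimension `d`, every `L ≥ 2` (Parts 3–6) resp. `L ≥ 4` (Part 2), every exponent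
sequence `σ` with the drop control `DropCtl σ m'`, ratio sequence `q = ratio L σ`; time `0` = the merge scale `j + 1`,
step `m` = print's scale `j + 1 + m`).
* Part 1 (minimality ⇒ failure): if `K` is a stopping index with memory `N ≥ 1`, `K − 1` is not, `K ≥ N + 1` and step
  `K − N` is clean, then the domain at step `K − N` VIOLATES (i) (`not_condI_of_minimal`; for `K = Nat.find`:
  `not_condI_find_sub`) — the windows of `K` and `K − 1` differ exactly in that step.
* Part 2 (failure ⇒ size, `L ≥ 4`): if `S^{i}(Z)` violates (i), `1 ≤ i` on the horizon, then `2^i ≤ 2·treeLen Z`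
  (`two_pow_le_of_not_condI`: contrapositive of `B16StoppingRule.condI_of_lt_one` and the scaling property
  `½·t_i ≤ (½)^i·t_0`); hence THE DURATION–SIZE LINK `2^{K−N} ≤ 2·treeLen Z` for the least stopping index `K ≥ N + 1`
  (`two_pow_find_sub_le`): a component outlives the memory by `T` steps only if its tree length is `≥ 2^{T−1}`.
* Part 3–4 (per-scale bounds along the flow restarted at `K₁`, via `B16MergeGeometry.exists_common_Siter` and
  `B16MergeHorizon.near_of_condI_touch` exactly as in `B16MergeHorizon.condI_merge`): for `X, Y` touching at the merge
  scale and `S^{K₁}(X)` satisfying (i), `K₁ ≥ 1`:  `#S^{K₁+t}(X ∪ Y) ≤ #S^{K₁+t}(Y) + 281^d` for every `t`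
  (`card_merge_le_281`: the orbit box of `S^{K₁}(X)` has side `≤ width + 2·shrink + 1 ≤ 80 + 200 + 1`), and
  `≤ #S^{K₁+t}(Y) + 83^d` for `t ≥ 14` (`card_merge_le_83`: `shrink ≤ 1` after `7` gaining steps); a domain satisfying
  (i) at step `K₂` has `#S^{K₂+t}(Y) ≤ 281^d` for every `t` (`card_le_281_of_condI`).
* Part 5 (the overhang profile and its sum): `overhang_m := #S^{m}(X ∪ Y) − [m ≤ K₂]·#S^{m}(Y)`; with the guarded profile
  `o_m = [K₁ < m]·overhang_m` the binder `hZ` of `controlsAm_merge` holds in cube currency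
  (`card_le_alive_add_overhang`: `#S^m(X ∪ Y) ≤ [m ≤ K₂]·#S^m(Y) + [m ≤ K₁]·#S^m(X) + o_m`, `K₁ ≤ K₂`;
  `sum_guarded_overhang`), and for any `K₂` and any `K` on the horizon
  `Σ_{K₁ < m ≤ K} overhang_m ≤ 83^d·(K₂ − K₁ − 13) + 2·281^d·(13 + (K − K₂))` (`sum_overhang_le`, truncated
  subtractions).
* Part 6 (THE AMORTISED FORM): logarithms are sublinear with any slope — `2^T ≤ 2(t+1) ⇒ T ≤ k + ((k+2)/2^k)·(t+1)` for
  every `k` (`le_add_div_of_two_pow_le`); hence, with the partner's remaining life `K₂ ≤ N + T`, `2^T ≤ 2(treeLen Y + 1)`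
  (Part 2 via `duration_witness`) and the merged horizon `K ≤ K₂ + 13 + N` (`B16MergeHorizon.find_stopAt_merge_le'`):
  `Σ_{K₁ < m ≤ K} overhang_m ≤ 2·281^d·(26 + N) + 83^d·(N + k) + 83^d·((k+2)/2^k)·(treeLen Y + 1)` for EVERY `k`
  (`sum_overhang_amortised`), and `Σ w_m·o_m ≤ W·Σ o_m` for weights `0 ≤ w_m ≤ W` (`weighted_sum_le`).
  READING: `η = W·83^d·(k+2)/2^k` is as small as desired, the fee `W·(2·281^d·(26+N) + 83^d·(N+k+1))` is
  `O_{d}(1)·L^{d+1}·M^dR_{j+1}^{d+1}·(R_{j+1} + k)` at `N = R_{j+1}`, `W ≤ L^{d+1}·O(1)M^dR_{j+1}^{d+1}` — the shape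
  of print's remainder `O(1)2(100M)^dR^{d+2}_{j+1}` in (1.88) (= `R_{j+1}` memory steps × `2·100^d` cubes × the weight
  `O(1)M^dR^{d+1}_{j+1}`) up to the constant.

WHAT IS NOT PROVED HERE (located, cell `GAPS.md` G-b02g11-1).  (a) The `N`-ary binder (`|S| ≥ 3`): summing binary
bounds over the pieces charges each dead piece a duration `~ log₂ treeLen(partner)`, which for MANY small pieces on one
large partner exceeds `η·Σ sizes + (|S|−1)·Fee` (`|S|·log` against `|S|`); the true mechanism is COALESCENCE of dead
pieces (from `14` steps after its death a piece's iterate lies in the one-layer shell of its partner's iterate,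
`B16Absorption.one_layer_absorption_dropCtl`, so distinct dead pieces stop costing separately), whose kernel form needs a
shell-cardinality bound and a `min`-accounting not typed here; the cell's exact box-algebra numerics (job ids in
`GAPS.md` G-b02g11-1) found no counterexample in the families (α)–(ζ) of `STEP.md` §7.11 (4) for `d ∈ {2,3,4}`,
`L ∈ {2,4}`.  (b) The currency: sizes here are CUBE COUNTS of the iterates; print's `d′_n` (tree length in `MR_n`-cubes)
is comparable up to the gluing constants of `B16MergeGeometry` / `TreeLength.card_le_treeLen` (cell `DIVERGENCE.md`
D-b02g9.3, D-b02g11.1) — the conversion is the consumer's.  (c) The weights and the `θ`-bookkeeping are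
`…StepInhabited`'s (Part N); this module supplies only the geometric inequality.  (d) CAVEAT as in `…B16MergeHorizon`:
condition (ii)'s cleanliness is the per-step parameter `Clean` of `…B16StoppingRule`; the minimality link (Part 1) needs
the step `K − N` clean, which print's standing assumption (p. 384: *"under the assumption that no large fields are
created in these steps"*) provides after the creation scale.
-/

namespace Literature.MathematicalPhysics.QuantumFieldTheory.Balaban1983to89.B16Overhang

open Literature.MathematicalPhysics.QuantumFieldTheory.Balaban1983to89
open Literature.MathematicalPhysics.QuantumFieldTheory.Balaban1983to89.B13ScaleTransfer
open Literature.MathematicalPhysics.QuantumFieldTheory.Balaban1983to89.B16SProfile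
open Literature.MathematicalPhysics.QuantumFieldTheory.Balaban1983to89.B16MergeGeometry
open Literature.MathematicalPhysics.QuantumFieldTheory.Balaban1983to89.B16Absorption
open Literature.MathematicalPhysics.QuantumFieldTheory.Balaban1983to89.B16StoppingRule
open Literature.MathematicalPhysics.QuantumFieldTheory.Balaban1983to89.B16MergeHorizon
open Literature.MathematicalPhysics.QuantumFieldTheory.Balaban1983to89.TreeLength

variable {d : ℕ}

section

/-! ## Part 1. Minimality of the stopping index: condition (i) FAILS `N` steps before the least stopping index -/

/-- If `K` is a stopping index (memory `N ≥ 1`) but `K − 1` is not, `K ≥ N + 1`, and the step `K − N` is clean, then the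
domain at step `K − N` VIOLATES condition (i): the windows of `K` and `K − 1` differ exactly in the step `K − N`.
[cite: Balaban1989LargeFieldII, p.384 (definition of K: "the smallest positive integer having the property")] -/
theorem not_condI_of_minimal {Nsz N : ℕ} {Clean : ℕ → Prop} {X : ℕ → Finset (Pt d)} {K : ℕ}
    (hK : StopAt Nsz N Clean X K) (hmin : ¬ StopAt Nsz N Clean X (K - 1)) (hN1 : 1 ≤ N) (hNK : N + 1 ≤ K)
    (hcl : Clean (K - N)) : ¬ CondI Nsz (X (K - N)) := by
  intro hI
  apply hmin
  obtain ⟨_, _, _, hwin⟩ := hK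
  refine ⟨by omega, ?_, by omega, fun l h1 h2 => ?_⟩
  · by_cases h : K < K - 1 + N
    · exact (hwin (K - 1) h (by omega)).2
    · have e : K - 1 = K - N := by omega
      rw [e]
      exact hI
  · by_cases h : K < l + N
    · exact hwin l h (by omega)
    · have e : l = K - N := by omega
      subst e
      exact ⟨hcl, hI⟩

/-- The same for `K = Nat.find`: the least stopping index `K` with `K ≥ N + 1` and the step `K − N` clean has (i) failing
at step `K − N`. [cite: Balaban1989LargeFieldII, p.384 (definition of K)] -/
theorem not_condI_find_sub {Nsz N : ℕ} {Clean : ℕ → Prop} {X : ℕ → Finset (Pt d)}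
    [DecidablePred (StopAt Nsz N Clean X)] (hex : ∃ K, StopAt Nsz N Clean X K) (hN1 : 1 ≤ N)
    (hNK : N + 1 ≤ Nat.find hex) (hcl : Clean (Nat.find hex - N)) :
    ¬ CondI Nsz (X (Nat.find hex - N)) :=
  not_condI_of_minimal (Nat.find_spec hex) (Nat.find_min hex (by omega)) hN1 hNK hcl

/-! ## Part 2. A failure of (i) forces size: `2^i ≤ 2·treeLen Z` if `S^{i}(Z)` violates (i) (`L ≥ 4`, drop control) -/

/-- Contrapositive of `B16StoppingRule.condI_of_lt_one`: if `S^{i}(Z)` violates (i) then the coarse-grained tree length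
at step `i` is at least one. [cite: Balaban1989LargeFieldII, p.385 l.3-5] -/
theorem one_le_treeLen_of_not_condI {L : ℕ} {σ : ℕ → ℕ} {m i : ℕ} (hL : 3 ≤ L) (h : DropCtl σ m)
    {Z : Finset (Pt d)} (hZ : Z.Nonempty) (hZc : FaceConnected Z) (hi : i ≤ m)
    (hI : ¬ CondI 100 (Siter (ratio L σ) i Z)) : 1 ≤ treeLen (closureIdx (Qprod (ratio L σ) i) Z) := by
  by_contra hlt
  exact hI (condI_of_lt_one hL h hZ hZc hi (not_le.mp hlt))

/-- THE DURATION–SIZE LINK: if `S^{i}(Z)` violates (i) for some `1 ≤ i` on the horizon, then `2^i ≤ 2·treeLen Z`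
(the scaling property `½·t_i ≤ (½)^i·t_0` of `B16SProfile.half_pow_mul_treeLen_ge` and `t_i ≥ 1`).
[cite: Balaban1989LargeFieldII, p.385 l.1-5] -/
theorem two_pow_le_of_not_condI {L : ℕ} {σ : ℕ → ℕ} {m i : ℕ} (hL : 4 ≤ L) (h : DropCtl σ m)
    {Z : Finset (Pt d)} (hZ : Z.Nonempty) (hZc : FaceConnected Z) (hi1 : 1 ≤ i) (hi : i ≤ m)
    (hI : ¬ CondI 100 (Siter (ratio L σ) i Z)) : (2 : ℝ) ^ i ≤ 2 * treeLen Z := by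
  have h1 := one_le_treeLen_of_not_condI (by omega) h hZ hZc hi hI
  have h2 := half_pow_mul_treeLen_ge hL h hZ hZc hi1 hi
  have h3 : (1 / 2 : ℝ) ≤ (1 / 2 : ℝ) ^ i * treeLen Z := by
    have : (1 / 2 : ℝ) * 1 ≤ (1 / 2 : ℝ) * treeLen (closureIdx (Qprod (ratio L σ) i) Z) :=
      mul_le_mul_of_nonneg_left h1 (by norm_num)
    linarith
  have h4 : (2 : ℝ) ^ i * ((1 / 2 : ℝ) ^ i * treeLen Z) = treeLen Z := by
    rw [← mul_assoc, ← mul_pow]; norm_num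
  have h5 : (0 : ℝ) ≤ (2 : ℝ) ^ i := by positivity
  calc (2 : ℝ) ^ i = 2 * ((2 : ℝ) ^ i * (1 / 2)) := by ring
    _ ≤ 2 * ((2 : ℝ) ^ i * ((1 / 2 : ℝ) ^ i * treeLen Z)) := by
        have := mul_le_mul_of_nonneg_left h3 h5
        linarith
    _ = 2 * treeLen Z := by rw [h4]

/-- THE LINK FOR THE LEAST STOPPING INDEX: if `K = Nat.find ≥ N + 1` (memory `N ≥ 1`, step `K − N` clean and on the
horizon), then `2^{K−N} ≤ 2·treeLen Z` — a component survives `K` steps only if its tree length is `≥ 2^{K−N−1}`.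
[cite: Balaban1989LargeFieldII, p.384 (definition of K), p.385 l.1-5] -/
theorem two_pow_find_sub_le {L : ℕ} {σ : ℕ → ℕ} {m : ℕ} (hL : 4 ≤ L) (h : DropCtl σ m)
    {Z : Finset (Pt d)} (hZ : Z.Nonempty) (hZc : FaceConnected Z) {N : ℕ} {Clean : ℕ → Prop} (hN1 : 1 ≤ N)
    [DecidablePred (StopAt 100 N Clean (fun l => Siter (ratio L σ) l Z))]
    (hex : ∃ K, StopAt 100 N Clean (fun l => Siter (ratio L σ) l Z) K)
    (hNK : N + 1 ≤ Nat.find hex) (hcl : Clean (Nat.find hex - N)) (hm : Nat.find hex - N ≤ m) :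
    (2 : ℝ) ^ (Nat.find hex - N) ≤ 2 * treeLen Z :=
  two_pow_le_of_not_condI hL h hZ hZc (by omega) hm (not_condI_find_sub hex hN1 hNK hcl)

/-! ## Part 3. Per-scale bounds along the restarted flow (relative indices) -/

/-- The side of the orbit box: `width t + 2·shrink D t + 1 ≤ 281` for `D ≤ 100` under the alternation (`width ≤ 80`,
`shrink ≤ D`). [folklore] -/
theorem side_le_281 {q : ℕ → ℕ} (hq : ∀ l, 0 < q l) {m : ℕ} (halt : ∀ l, l + 2 ≤ m → 2 ≤ q l ∨ 2 ≤ q (l + 1))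
    {D : ℤ} (hD0 : 0 ≤ D) (hD : D ≤ 100) (t : ℕ) (ht : t ≤ m) :
    (width q t + 2 * shrink q D t + 1).toNat ≤ 281 := by
  have hw := (width_le_eighty hq halt t ht).1
  have hs : shrink q D t ≤ D :=
    (shrink_le_cdiv_pow hq hD0 t).trans (cdiv_le_self (by positivity) hD0)
  exact Int.toNat_le.mpr (by push_cast; omega)

/-- From step `14` on the side is `≤ 83`: `shrink D t ≤ 1` once `2^{gains t} ≥ 2^7 ≥ D` (`⌊t/2⌋ ≤ gains t`).
[folklore] -/
theorem side_le_83 {q : ℕ → ℕ} (hq : ∀ l, 0 < q l) {m : ℕ} (halt : ∀ l, l + 2 ≤ m → 2 ≤ q l ∨ 2 ≤ q (l + 1))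
    {D : ℤ} (hD0 : 0 ≤ D) (hD : D ≤ 128) (t : ℕ) (h14 : 14 ≤ t) (ht : t ≤ m) :
    (width q t + 2 * shrink q D t + 1).toNat ≤ 83 := by
  have hw := (width_le_eighty hq halt t ht).1
  have hg7 : 7 ≤ gains q t := le_trans (by omega) (div_two_le_gains_of_altGain halt t ht)
  have hg : D ≤ 2 ^ gains q t := by
    have h2 : (2 : ℤ) ^ 7 ≤ 2 ^ gains q t := pow_le_pow_right₀ (by norm_num) hg7
    linarith
  have hs := shrink_le_one_of_gains hq hD0 hg
  exact Int.toNat_le.mpr (by push_cast; omega)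

/-- Per-scale OVERHANG of `X` over `Y` along any ratio sequence: `#S^{t}(X ∪ Y) ≤ #S^{t}(Y) + B^d` whenever the side of
the orbit box of `X` at step `t` is `≤ B`. [folklore] -/
theorem card_union_le_add_pow {q : ℕ → ℕ} (hq : ∀ l, 0 < q l) {X Y : Finset (Pt d)} {c : Pt d} {D : ℤ}
    (hX : ∀ x ∈ X, ∀ i, c i - D ≤ x i ∧ x i ≤ c i + D) (t : ℕ) {B : ℕ}
    (hB : (width q t + 2 * shrink q D t + 1).toNat ≤ B) :
    (Siter q t (X ∪ Y)).card ≤ (Siter q t Y).card + B ^ d :=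
  (card_Siter_union_le hq hX t).trans (Nat.add_le_add_left (Nat.pow_le_pow_left hB d) _)

/-! ## Part 4. Per-scale bounds in absolute indices (time `0` = the merge scale; `q = ratio L σ`, drop control on `m'`) -/

/-- OVERHANG WHILE THE PARTNER IS ALIVE, ALL STEPS: for `X, Y` touching at the merge scale and `S^{K₁}(X)` satisfying
(i) (`K₁ ≥ 1`), `#S^{K₁+t}(X ∪ Y) ≤ #S^{K₁+t}(Y) + 281^d` for every `t` on the horizon.
[cite: Balaban1989LargeFieldII, p.387 l.8-15] -/
theorem card_merge_le_281 {L : ℕ} (hL : 2 ≤ L) {σ : ℕ → ℕ} {m' : ℕ} (hσ : DropCtl σ m')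
    {X Y : Finset (Pt d)} {a₀ c₀ : Pt d} (ha₀ : a₀ ∈ X) (hc₀ : c₀ ∈ Y) (h₀ : Touch a₀ c₀)
    {K₁ : ℕ} (hK₁ : 1 ≤ K₁) (hXI : CondI 100 (Siter (ratio L σ) K₁ X)) (t : ℕ) (ht : K₁ + t ≤ m') :
    (Siter (ratio L σ) (K₁ + t) (X ∪ Y)).card ≤ (Siter (ratio L σ) (K₁ + t) Y).card + 281 ^ d := by
  have hq : ∀ l, 0 < ratio L σ l := fun l => ratio_pos (by omega) σ l
  obtain ⟨e, heX, heY⟩ := exists_common_Siter hq ha₀ hc₀ h₀ hK₁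
  have hX := near_of_condI_touch hXI heX (Touch.refl e)
  rw [Siter_add, Siter_add _ _ Y, ratio_shift_fun, Siter_union]
  have hq' : ∀ l, 0 < ratio L (fun n => σ (K₁ + n)) l := fun l => ratio_pos (by omega) _ l
  have halt := altGain_ratio hL (dropCtl_shift hσ K₁)
  exact card_union_le_add_pow hq' hX t (side_le_281 hq' halt (by norm_num) (by norm_num) t (by omega))

/-- OVERHANG WHILE THE PARTNER IS ALIVE, FROM STEP `14` ON: `#S^{K₁+t}(X ∪ Y) ≤ #S^{K₁+t}(Y) + 83^d` for `t ≥ 14` on the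
horizon (one-layer regime of `B16Absorption.one_layer_absorption_dropCtl`). [cite: Balaban1989LargeFieldII, p.387 l.8-15] -/
theorem card_merge_le_83 {L : ℕ} (hL : 2 ≤ L) {σ : ℕ → ℕ} {m' : ℕ} (hσ : DropCtl σ m')
    {X Y : Finset (Pt d)} {a₀ c₀ : Pt d} (ha₀ : a₀ ∈ X) (hc₀ : c₀ ∈ Y) (h₀ : Touch a₀ c₀)
    {K₁ : ℕ} (hK₁ : 1 ≤ K₁) (hXI : CondI 100 (Siter (ratio L σ) K₁ X)) (t : ℕ) (h14 : 14 ≤ t) (ht : K₁ + t ≤ m') :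
    (Siter (ratio L σ) (K₁ + t) (X ∪ Y)).card ≤ (Siter (ratio L σ) (K₁ + t) Y).card + 83 ^ d := by
  have hq : ∀ l, 0 < ratio L σ l := fun l => ratio_pos (by omega) σ l
  obtain ⟨e, heX, heY⟩ := exists_common_Siter hq ha₀ hc₀ h₀ hK₁
  have hX := near_of_condI_touch hXI heX (Touch.refl e)
  rw [Siter_add, Siter_add _ _ Y, ratio_shift_fun, Siter_union]
  have hq' : ∀ l, 0 < ratio L (fun n => σ (K₁ + n)) l := fun l => ratio_pos (by omega) _ l
  have halt := altGain_ratio hL (dropCtl_shift hσ K₁)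
  exact card_union_le_add_pow hq' hX t (side_le_83 hq' halt (by norm_num) (by norm_num) t h14 (by omega))

/-- A DOMAIN PAST A STEP AT WHICH IT SATISFIES (i) STAYS SMALL: if `S^{K₂}(Y)` satisfies (i) then
`#S^{K₂+t}(Y) ≤ 281^d` for every `t` on the horizon. [cite: Balaban1989LargeFieldII, p.387 l.8-15] -/
theorem card_le_281_of_condI {L : ℕ} (hL : 2 ≤ L) {σ : ℕ → ℕ} {m' : ℕ} (hσ : DropCtl σ m')
    {Y : Finset (Pt d)} (hY : Y.Nonempty) {K₂ : ℕ} (hYI : CondI 100 (Siter (ratio L σ) K₂ Y)) (t : ℕ)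
    (ht : K₂ + t ≤ m') : (Siter (ratio L σ) (K₂ + t) Y).card ≤ 281 ^ d := by
  have hq : ∀ l, 0 < ratio L σ l := fun l => ratio_pos (by omega) σ l
  obtain ⟨y, hy⟩ := Siter_nonempty (ratio L σ) hY K₂
  have hX := near_of_condI_touch hYI hy (Touch.refl y)
  rw [Siter_add, ratio_shift_fun]
  have hq' : ∀ l, 0 < ratio L (fun n => σ (K₂ + n)) l := fun l => ratio_pos (by omega) _ l
  have halt := altGain_ratio hL (dropCtl_shift hσ K₂)
  exact (card_Siter_le_pow hq' hX t).trans
    (Nat.pow_le_pow_left (side_le_281 hq' halt (by norm_num) (by norm_num) t (by omega)) d)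

/-! ## Part 5. The dead overhang profile of a binary merger and its sum over the merged horizon (cube currency) -/

/-- THE DEAD OVERHANG PROFILE of the binary merger `Z = X ∪ Y` in cube currency (NOT PRINTED — cell bookkeeping of
`Step.Budget.controlsAm_merge`, binder `hZ`/`hover`, at `|S| = 2`): at step `m` after the merge scale, the cubes of
`S^{m}(X ∪ Y)` not accounted to the partner `Y` while `Y` is alive (`m ≤ K₂`), and all of `S^{m}(X ∪ Y)` afterwards.
[folklore] -/
noncomputable def overhang (q : ℕ → ℕ) (X Y : Finset (Pt d)) (K₂ m : ℕ) : ℕ :=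
  (Siter q m (X ∪ Y)).card - if m ≤ K₂ then (Siter q m Y).card else 0

/-- The shape of the binder `hZ` of `Step.Budget.controlsAm_merge` at `|S| = 2` in cube currency, with the dead
overhang profile `o_m = [K₁ < m]·overhang_m` (`X` alive through step `K₁`, `Y` through step `K₂ ≥ K₁`): the size of
the merged iterate is at most the sizes of the iterates of the pieces alive at that step plus `o_m`. [folklore] -/
theorem card_le_alive_add_overhang (q : ℕ → ℕ) (X Y : Finset (Pt d)) {K₁ K₂ : ℕ} (h12 : K₁ ≤ K₂) (m : ℕ) :
    (Siter q m (X ∪ Y)).card ≤ ((if m ≤ K₂ then (Siter q m Y).card else 0) +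
      (if m ≤ K₁ then (Siter q m X).card else 0)) + (if K₁ < m then overhang q X Y K₂ m else 0) := by
  have hu : (Siter q m (X ∪ Y)).card ≤ (Siter q m X).card + (Siter q m Y).card := by
    rw [Siter_union]
    exact Finset.card_union_le _ _
  unfold overhang
  split_ifs <;> omega

/-- The guarded profile sums, over the merged horizon `0 < m ≤ K`, to the overhang sum over `K₁ < m ≤ K`. [folklore] -/
theorem sum_guarded_overhang (q : ℕ → ℕ) (X Y : Finset (Pt d)) (K₁ K₂ K : ℕ) :
    ∑ m ∈ Finset.Ioc 0 K, (if K₁ < m then overhang q X Y K₂ m else 0) =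
      ∑ m ∈ Finset.Ioc K₁ K, overhang q X Y K₂ m := by
  rw [← Finset.sum_filter]
  congr 1
  ext m
  simp only [Finset.mem_filter, Finset.mem_Ioc]
  omega

/-- THE SUMMED OVERHANG OF A BINARY MERGER (time `0` = the merge scale; `X, Y` touching there; `S^{K₁}(X)` and
`S^{K₂}(Y)` satisfy (i), `1 ≤ K₁`; any `K₂`, any `K` on the horizon): over the steps `K₁ < m ≤ K` the overhang totals at most
`83^d·(K₂ − K₁ − 13) + 2·281^d·(13 + (K − K₂))` cubes — `≤ 281^d` per step for the first `13` steps after `K₁`,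
`≤ 83^d` per step while `Y` is alive from step `K₁ + 14` on, `≤ 2·281^d` per step after `K₂`.
[cite: Balaban1989LargeFieldII, p.387 l.8-15; (1.88) p.387] -/
theorem sum_overhang_le {L : ℕ} (hL : 2 ≤ L) {σ : ℕ → ℕ} {m' : ℕ} (hσ : DropCtl σ m')
    {X Y : Finset (Pt d)} {a₀ c₀ : Pt d} (ha₀ : a₀ ∈ X) (hc₀ : c₀ ∈ Y) (h₀ : Touch a₀ c₀) (hY : Y.Nonempty)
    {K₁ K₂ : ℕ} (hK₁ : 1 ≤ K₁)
    (hXI : CondI 100 (Siter (ratio L σ) K₁ X)) (hYI : CondI 100 (Siter (ratio L σ) K₂ Y)) {K : ℕ} (hKm : K ≤ m') :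
    ∑ m ∈ Finset.Ioc K₁ K, overhang (ratio L σ) X Y K₂ m ≤
      83 ^ d * (K₂ - (K₁ + 13)) + 2 * 281 ^ d * (13 + (K - K₂)) := by
  classical
  set P : ℕ → Prop := fun m => K₁ + 14 ≤ m ∧ m ≤ K₂ with hP
  rw [← Finset.sum_filter_add_sum_filter_not (Finset.Ioc K₁ K) P]
  apply add_le_add
  · have hb : ∀ m ∈ (Finset.Ioc K₁ K).filter P, overhang (ratio L σ) X Y K₂ m ≤ 83 ^ d := by
      intro m hm
      simp only [Finset.mem_filter, Finset.mem_Ioc, hP] at hm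
      obtain ⟨t, rfl⟩ : ∃ t, m = K₁ + t := ⟨m - K₁, by omega⟩
      have h := card_merge_le_83 hL hσ ha₀ hc₀ h₀ hK₁ hXI t (by omega) (by omega)
      have hB : 0 < 83 ^ d := Nat.pow_pos (by norm_num)
      unfold overhang
      rw [if_pos (by omega)]
      omega
    have hc : ((Finset.Ioc K₁ K).filter P).card ≤ K₂ - (K₁ + 13) := by
      calc ((Finset.Ioc K₁ K).filter P).card ≤ (Finset.Ioc (K₁ + 13) K₂).card := by
            apply Finset.card_le_card
            intro m hm
            simp only [Finset.mem_filter, Finset.mem_Ioc, hP] at hm ⊢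
            omega
        _ = K₂ - (K₁ + 13) := Nat.card_Ioc _ _
    calc ∑ m ∈ (Finset.Ioc K₁ K).filter P, overhang (ratio L σ) X Y K₂ m
        ≤ ((Finset.Ioc K₁ K).filter P).card • 83 ^ d := Finset.sum_le_card_nsmul _ _ _ hb
      _ ≤ 83 ^ d * (K₂ - (K₁ + 13)) := by
          rw [smul_eq_mul, Nat.mul_comm]
          exact Nat.mul_le_mul_left _ hc
  · have hb : ∀ m ∈ (Finset.Ioc K₁ K).filter (fun m => ¬ P m), overhang (ratio L σ) X Y K₂ m ≤ 2 * 281 ^ d := by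
      intro m hm
      simp only [Finset.mem_filter, Finset.mem_Ioc, hP, not_and_or, not_le] at hm
      obtain ⟨t, rfl⟩ : ∃ t, m = K₁ + t := ⟨m - K₁, by omega⟩
      have h := card_merge_le_281 hL hσ ha₀ hc₀ h₀ hK₁ hXI t (by omega)
      have hB : 0 < 281 ^ d := Nat.pow_pos (by norm_num)
      unfold overhang
      by_cases hm2 : K₁ + t ≤ K₂
      · rw [if_pos hm2]
        omega
      · rw [if_neg hm2]
        obtain ⟨u, hu⟩ : ∃ u, K₁ + t = K₂ + u := ⟨K₁ + t - K₂, by omega⟩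
        have h' := card_le_281_of_condI hL hσ hY hYI u (by omega)
        rw [← hu] at h'
        omega
    have hc : ((Finset.Ioc K₁ K).filter (fun m => ¬ P m)).card ≤ 13 + (K - K₂) := by
      calc ((Finset.Ioc K₁ K).filter (fun m => ¬ P m)).card
          ≤ (Finset.Ioc K₁ (K₁ + 13) ∪ Finset.Ioc K₂ K).card := by
            apply Finset.card_le_card
            intro m hm
            simp only [Finset.mem_filter, Finset.mem_Ioc, hP, not_and_or, not_le] at hm
            simp only [Finset.mem_union, Finset.mem_Ioc]
            omega
        _ ≤ (Finset.Ioc K₁ (K₁ + 13)).card + (Finset.Ioc K₂ K).card := Finset.card_union_le _ _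
        _ = 13 + (K - K₂) := by rw [Nat.card_Ioc, Nat.card_Ioc]; omega
    calc ∑ m ∈ (Finset.Ioc K₁ K).filter (fun m => ¬ P m), overhang (ratio L σ) X Y K₂ m
        ≤ ((Finset.Ioc K₁ K).filter (fun m => ¬ P m)).card • (2 * 281 ^ d) := Finset.sum_le_card_nsmul _ _ _ hb
      _ ≤ 2 * 281 ^ d * (13 + (K - K₂)) := by
          rw [smul_eq_mul, Nat.mul_comm]
          exact Nat.mul_le_mul_left _ hc

/-! ## Part 6. The amortised form: durations are logarithmic in the partner's size, logarithms are sublinear -/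

/-- `n·2^{k+1} ≤ (k+2)·2^n` for `n ≥ k + 1`. [folklore] -/
theorem mul_two_pow_le (k : ℕ) : ∀ n : ℕ, k + 1 ≤ n → (n : ℝ) * 2 ^ (k + 1) ≤ (k + 2) * 2 ^ n := by
  intro n hn
  induction n, hn using Nat.le_induction with
  | base =>
    have h0 : (0 : ℝ) ≤ 2 ^ (k + 1) := by positivity
    push_cast
    nlinarith
  | succ n hn ih =>
    have h0 : (0 : ℝ) ≤ 2 ^ (k + 1) := by positivity
    have h1 : (1 : ℝ) ≤ n := by exact_mod_cast (show 1 ≤ n by omega)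
    have hk : (0 : ℝ) ≤ k := Nat.cast_nonneg k
    push_cast
    calc ((n : ℝ) + 1) * 2 ^ (k + 1) ≤ (2 * n) * 2 ^ (k + 1) := mul_le_mul_of_nonneg_right (by linarith) h0
      _ = 2 * (n * 2 ^ (k + 1)) := by ring
      _ ≤ 2 * ((k + 2) * 2 ^ n) := by linarith
      _ = (k + 2) * 2 ^ (n + 1) := by ring

/-- LOGARITHMS ARE SUBLINEAR WITH ANY SLOPE: `2^T ≤ 2(t + 1)` implies `T ≤ k + ((k+2)/2^k)·(t + 1)` for every `k`
(the slope `(k+2)/2^k` is as small as desired). [folklore] -/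
theorem le_add_div_of_two_pow_le {T : ℕ} {t : ℝ} (ht : 0 ≤ t) (hT : (2 : ℝ) ^ T ≤ 2 * (t + 1)) (k : ℕ) :
    (T : ℝ) ≤ k + (k + 2) / 2 ^ k * (t + 1) := by
  have hnn : (0 : ℝ) ≤ (k + 2) / 2 ^ k * (t + 1) := by positivity
  rcases Nat.lt_or_ge T (k + 1) with hlt | hge
  · have : (T : ℝ) ≤ k := by exact_mod_cast (show T ≤ k by omega)
    linarith
  · have h1 := mul_two_pow_le k T hge
    have h3 : (T : ℝ) * 2 ^ k * 2 ≤ (k + 2) * (t + 1) * 2 := by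
      calc (T : ℝ) * 2 ^ k * 2 = T * 2 ^ (k + 1) := by ring
        _ ≤ (k + 2) * 2 ^ T := h1
        _ ≤ (k + 2) * (2 * (t + 1)) := mul_le_mul_of_nonneg_left hT (by positivity)
        _ = (k + 2) * (t + 1) * 2 := by ring
    have h4 : (T : ℝ) * 2 ^ k ≤ (k + 2) * (t + 1) := le_of_mul_le_mul_right h3 (by norm_num)
    have hk0 : (0 : ℝ) ≤ k := Nat.cast_nonneg k
    have h5 : ((k : ℝ) + 2) / 2 ^ k * (t + 1) = ((k + 2) * (t + 1)) / 2 ^ k := by ring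
    have h6 : (T : ℝ) ≤ ((k + 2) * (t + 1)) / 2 ^ k := by
      rw [le_div_iff₀ (by positivity)]
      exact h4
    linarith

/-- THE DURATION WITNESS: from the duration–size link (`two_pow_find_sub_le`: `2^{K₂−N} ≤ 2·treeLen Y` once
`K₂ ≥ N + 1`) the exponent `T = K₂ − N` has `K₂ ≤ N + T` and `2^T ≤ 2(treeLen Y + 1)` (also when `K₂ ≤ N`). [folklore] -/
theorem duration_witness {K₂ N : ℕ} {t : ℝ} (ht : 0 ≤ t) (h : N + 1 ≤ K₂ → (2 : ℝ) ^ (K₂ - N) ≤ 2 * t) :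
    K₂ ≤ N + (K₂ - N) ∧ (2 : ℝ) ^ (K₂ - N) ≤ 2 * (t + 1) := by
  refine ⟨by omega, ?_⟩
  rcases Nat.lt_or_ge K₂ (N + 1) with hlt | hge
  · rw [show K₂ - N = 0 by omega, pow_zero]
    linarith
  · linarith [h hge]

/-- THE AMORTISED OVERHANG INEQUALITY OF A BINARY MERGER (cube currency, unit weights; time `0` = the merge scale):
for `X, Y` touching at the merge scale, `Y` non-empty, `S^{K₁}(X)`, `S^{K₂}(Y)` satisfying (i) with `1 ≤ K₁`,
the partner's remaining life `K₂ ≤ N + T` with `2^T ≤ 2(treeLen Y + 1)` (Part 2: minimality of the stopping index with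
memory `N`), and the merged horizon `K ≤ K₂ + 13 + N` (`B16MergeHorizon.find_stopAt_merge_le'`) on the flow's horizon:
for EVERY `k`,
`Σ_{K₁ < m ≤ K} overhang_m ≤ 2·281^d·(26 + N) + 83^d·(N + k) + 83^d·((k+2)/2^k)·(treeLen Y + 1)`
— a FEE linear in the memory `N` plus an arbitrarily small multiple (choose `k`) of the partner's size.  This is the
binder `hover` of `Step.Budget.controlsAm_merge` at `|S| = 2` in cube currency, up to the weights
`w_n = O(1)M^dR_n^{d+1}` (bounded ratio along the horizon by (2.9a), `Step.Budget.RStepLe`; `weighted_sum_le`).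
NOT PRINTED: print asserts `S^{n−j−1}(Z) = S^{n−j−1}(Y)` (no overhang at all), refuted in the model by
`B16Absorption.no_uniform_absorption`. [cite: Balaban1989LargeFieldII, (1.88) p.387; p.387 l.8-15] -/
theorem sum_overhang_amortised {L : ℕ} (hL : 2 ≤ L) {σ : ℕ → ℕ} {m' : ℕ} (hσ : DropCtl σ m')
    {X Y : Finset (Pt d)} {a₀ c₀ : Pt d} (ha₀ : a₀ ∈ X) (hc₀ : c₀ ∈ Y) (h₀ : Touch a₀ c₀) (hY : Y.Nonempty)
    {K₁ K₂ : ℕ} (hK₁ : 1 ≤ K₁)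
    (hXI : CondI 100 (Siter (ratio L σ) K₁ X)) (hYI : CondI 100 (Siter (ratio L σ) K₂ Y))
    {N T K : ℕ} (hK2 : K₂ ≤ N + T) (hT : (2 : ℝ) ^ T ≤ 2 * (treeLen Y + 1)) (hK : K ≤ K₂ + 13 + N) (hKm : K ≤ m')
    (k : ℕ) :
    ((∑ m ∈ Finset.Ioc K₁ K, overhang (ratio L σ) X Y K₂ m : ℕ) : ℝ) ≤
      2 * 281 ^ d * (26 + N) + 83 ^ d * (N + k) + 83 ^ d * ((k + 2) / 2 ^ k) * (treeLen Y + 1) := by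
  have h1 := sum_overhang_le hL hσ ha₀ hc₀ h₀ hY hK₁ hXI hYI hKm (K := K)
  have h2 : K₂ - (K₁ + 13) ≤ N + T := by omega
  have h3 : 13 + (K - K₂) ≤ 26 + N := by omega
  have h4 : ∑ m ∈ Finset.Ioc K₁ K, overhang (ratio L σ) X Y K₂ m ≤ 83 ^ d * (N + T) + 2 * 281 ^ d * (26 + N) :=
    h1.trans (add_le_add (Nat.mul_le_mul_left _ h2) (Nat.mul_le_mul_left _ h3))
  have h5 := le_add_div_of_two_pow_le (treeLen_nonneg Y) hT k
  have h6 : ((∑ m ∈ Finset.Ioc K₁ K, overhang (ratio L σ) X Y K₂ m : ℕ) : ℝ) ≤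
      (83 : ℝ) ^ d * (N + T) + 2 * 281 ^ d * (26 + N) := by exact_mod_cast h4
  have h83 : (0 : ℝ) ≤ 83 ^ d := by positivity
  have h7 := mul_le_mul_of_nonneg_left h5 h83
  have e : (83 : ℝ) ^ d * (↑k + (↑k + 2) / 2 ^ k * (treeLen Y + 1)) =
      83 ^ d * k + 83 ^ d * ((k + 2) / 2 ^ k) * (treeLen Y + 1) := by ring
  linarith

/-- WEIGHTS: with per-step weights `0 ≤ w_m ≤ W` (the cost factors `O(1)M^dR_{j+1+m}^{d+1}`, of bounded ratio along the
horizon by (2.9a)) the weighted overhang sum is at most `W` times the unweighted one. [folklore] -/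
theorem weighted_sum_le {s : Finset ℕ} {o : ℕ → ℕ} {w : ℕ → ℝ} {W : ℝ} (hw : ∀ m ∈ s, 0 ≤ w m ∧ w m ≤ W) :
    ∑ m ∈ s, w m * o m ≤ W * ((∑ m ∈ s, o m : ℕ) : ℝ) := by
  push_cast
  rw [Finset.mul_sum]
  exact Finset.sum_le_sum fun m hm => mul_le_mul_of_nonneg_right (hw m hm).2 (Nat.cast_nonneg _)

end

end Literature.MathematicalPhysics.QuantumFieldTheory.Balaban1983to89.B16Overhang
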